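import Mathlib
import Literature.RingTheory.KrullDimension.AffineDimension
import Literature.AlgebraicGeometry.Resolution.RegularLocalRingsProofs
import Literature.AlgebraicGeometry.Resolution.RegularLocalRingsQuotient
import Summits.ResolutionOfSingularities.ResolutionOfSingularities.Theorems.PAlterationPicoverLocalModelTransversalExit
import HarnessLib

/-!
# Crux `Picover` (stmt-ResolutionOfSingularities-0554), line `degree-p-tower` — the DEGENERATE
# exit of the local model `t^p = u`

Registered helper `not_isRegularLocalRing_adjoinRoot_of_mem_sq`. Setting: `(O, 𝔪, κ)` a regular
local ring of prime characteristic `p`, `u, c ∈ O` with `m := u - c^p ∈ 𝔪²`. Claim: the purely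
inseparable cover `O' := O[T]/(T^p - u) = AdjoinRoot (X^p - C u)` is NOT a regular ring. This is
the converse of the transversal exit `isRegularLocalRing_adjoinRoot_of_transversal`
(`m ∈ 𝔪 ∖ 𝔪² ⇒ O'` regular local).

Proof (embedding-dimension count). Put `τ := t - c ∈ O'`, so `τ^p = m` (`root_sub_of_pow_eq`);
`O'` is local with maximal ideal `𝔐 = 𝔪O' + (τ)` (`isLocalRing_adjoinRoot_of_transversal`, which
only uses `m ∈ 𝔪`). If `O'` were a regular ring it would be a regular local ring, so
`emb dim O' = dim O' ≤ dim O = emb dim O` (`O'` is integral over `O`). But: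

* `τ ∉ 𝔐²`: otherwise `𝔐 ⊆ 𝔪O' + 𝔐²`, so `𝔐 = 𝔪O'` (Nakayama) and `τ ∈ 𝔪O'`; reducing modulo
  `𝔪` in `O'/𝔪O' → κ[X]/(X^p - ū)` gives `X - c̄ ≡ 0`, impossible as `p > 1`;
* hence `emb dim O'/(τ) + 1 = emb dim O'` (`spanFinrank_maximalIdeal_quotient_add_one`);
* `O'/(τ) ≅ O/(m)` (`t ↦ c`: the kernel of `O' → O/(m)` is `(τ)` since `g ≡ g(c) mod (T - c)` and
  `m = τ^p`), so `emb dim O'/(τ) = emb dim O/(m)`;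
* `emb dim O/(m) = emb dim O` because `m ∈ 𝔪²` dies in the cotangent space
  (`spanFinrank_maximalIdeal_add_finrank_eq_of_surjective`).

Together `emb dim O' = emb dim O + 1 > emb dim O`, a contradiction. (The hypothesis
`1 ≤ dim O` of the registered signature is not needed.) No statement item is restated.
-/

set_option linter.dupNamespace false -- mandated namespace of this single-conjunct summit

noncomputable section

universe u

namespace Summit.ResolutionOfSingularities.ResolutionOfSingularities.Theorems.PicoverLocalModel.DegenerateExit

open Polynomial IsLocalRing Literature.AlgebraicGeometry.Resolution
open Summit.ResolutionOfSingularities.ResolutionOfSingularities.Theorems.PicoverLocalModel.TransversalExit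

/-- **Degenerate exit of the local model.** Let `(O, 𝔪)` be a regular local ring of prime
characteristic `p` and `u, c ∈ O` with `u - c^p ∈ 𝔪²`. Then the purely inseparable cover
`O' = O[T]/(T^p - u)` is not a regular ring: it is local with maximal ideal `𝔐 = 𝔪O' + (τ)`,
`τ = t - c`, `τ ∉ 𝔐²`, and `O'/(τ) ≅ O/(u - c^p)` has embedding dimension `emb dim O = dim O`
(as `u - c^p ∈ 𝔪²`), so `emb dim O' = dim O + 1 > dim O ≥ dim O'`. [folklore] -/
theorem not_isRegularLocalRing_adjoinRoot_of_mem_sq : ∀ {O : Type u} [CommRing O] [IsRegularLocalRing O] (p : ℕ) [Fact p.Prime] [CharP O p] (u c : O), u - c ^ p ∈ IsLocalRing.maximalIdeal O ^ 2 → 1 ≤ ringKrullDim O → ¬ IsRegularRing (AdjoinRoot ((Polynomial.X : Polynomial O) ^ p - Polynomial.C u)) := by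
  intro O _ _ p _ _ u c hm2 _ hreg
  have hp : p.Prime := Fact.out
  have hm : u - c ^ p ∈ maximalIdeal O := Ideal.pow_le_self two_ne_zero hm2
  have hτp := root_sub_of_pow_eq p u c
  obtain ⟨_, hmax⟩ := isLocalRing_adjoinRoot_of_transversal p (u := u) (c := c) hm
  set f : O[X] := X ^ p - C u with hf_def
  have hf : f.Monic := monic_X_pow_sub_C u hp.ne_zero
  haveI : Module.Finite O (AdjoinRoot f) := hf.finite_adjoinRoot
  haveI : Algebra.IsIntegral O (AdjoinRoot f) := inferInstance
  haveI : IsRegularRing (AdjoinRoot f) := hreg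
  haveI : IsRegularLocalRing (AdjoinRoot f) :=
    IsRegularLocalRing.of_isRegularRing_of_isLocalRing _
  have hτM : AdjoinRoot.root f - AdjoinRoot.of f c ∈ maximalIdeal (AdjoinRoot f) := by
    rw [hmax]
    exact Ideal.mem_sup_right (Ideal.mem_span_singleton_self _)
  -- Step 1: `τ ∉ 𝔪O'` (reduce modulo `𝔪`: `X - c̄` is not divisible by `X^p - ū`)
  have hτ1 : AdjoinRoot.root f - AdjoinRoot.of f c ∉ (maximalIdeal O).map (AdjoinRoot.of f) := by
    intro h
    have hfb : (f.map (residue O)).Monic := hf.map _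
    let ψ : AdjoinRoot f →+* AdjoinRoot (f.map (residue O)) :=
      AdjoinRoot.map (residue O) f (f.map (residue O)) dvd_rfl
    have h1 : (maximalIdeal O).map (AdjoinRoot.of f) ≤ RingHom.ker ψ := by
      rw [Ideal.map_le_iff_le_comap]
      intro x hx
      rw [Ideal.mem_comap, RingHom.mem_ker, AdjoinRoot.map_of, (residue_eq_zero_iff x).mpr hx,
        map_zero]
    have h2 := h1 h
    rw [RingHom.mem_ker, map_sub, AdjoinRoot.map_root, AdjoinRoot.map_of] at h2
    have h3 : AdjoinRoot.mk (f.map (residue O)) (X - C (residue O c)) = 0 := by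
      rw [map_sub, AdjoinRoot.mk_X, AdjoinRoot.mk_C]
      exact h2
    refine AdjoinRoot.mk_ne_zero_of_natDegree_lt hfb (X_sub_C_ne_zero _) ?_ h3
    rw [natDegree_X_sub_C, hf.natDegree_map, hf_def, natDegree_X_pow_sub_C]
    exact hp.one_lt
  -- Step 2: `τ ∉ 𝔐²` (Nakayama)
  have hτ2 : AdjoinRoot.root f - AdjoinRoot.of f c ∉ maximalIdeal (AdjoinRoot f) ^ 2 := by
    intro h
    apply hτ1
    have key : maximalIdeal (AdjoinRoot f) ≤ (maximalIdeal O).map (AdjoinRoot.of f) := by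
      refine Submodule.le_of_le_smul_of_le_jacobson_bot (IsNoetherian.noetherian _)
        (maximalIdeal_le_jacobson _) ?_
      rw [smul_eq_mul, ← pow_two]
      calc maximalIdeal (AdjoinRoot f)
          = (maximalIdeal O).map (AdjoinRoot.of f) ⊔
              Ideal.span {AdjoinRoot.root f - AdjoinRoot.of f c} := hmax
        _ ≤ (maximalIdeal O).map (AdjoinRoot.of f) ⊔ maximalIdeal (AdjoinRoot f) ^ 2 :=
            sup_le_sup_left ((Ideal.span_singleton_le_iff_mem _).mpr h) _
    exact key hτM
  -- Step 3: the surjection `O' → O/(m)`, `t ↦ c̄`, has kernel `(τ)`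
  set I : Ideal O := Ideal.span {u - c ^ p} with hI_def
  have hfI : f.eval₂ (Ideal.Quotient.mk I) (Ideal.Quotient.mk I c) = 0 := by
    rw [eval₂_hom, Ideal.Quotient.eq_zero_iff_mem, hf_def, eval_sub, eval_pow, eval_X, eval_C,
      ← neg_sub]
    exact I.neg_mem (Ideal.mem_span_singleton_self _)
  set φ : AdjoinRoot f →+* O ⧸ I := AdjoinRoot.lift (Ideal.Quotient.mk I) (Ideal.Quotient.mk I c) hfI
    with hφ_def
  have hsurj : Function.Surjective φ := fun x => by
    obtain ⟨a, rfl⟩ := Ideal.Quotient.mk_surjective x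
    exact ⟨AdjoinRoot.of f a, AdjoinRoot.lift_of hfI⟩
  have hker : RingHom.ker φ = Ideal.span {AdjoinRoot.root f - AdjoinRoot.of f c} := by
    apply le_antisymm
    · intro x hx
      obtain ⟨g, rfl⟩ := AdjoinRoot.mk_surjective x
      rw [RingHom.mem_ker, hφ_def, AdjoinRoot.lift_mk, eval₂_hom, Ideal.Quotient.eq_zero_iff_mem,
        hI_def, Ideal.mem_span_singleton'] at hx
      obtain ⟨r, hr⟩ := hx
      -- `g = g(c) + (T - c) q`
      obtain ⟨q, hq⟩ := X_sub_C_dvd_sub_C_eval (a := c) (p := g)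
      have hg : AdjoinRoot.mk f g = AdjoinRoot.of f (g.eval c) +
          (AdjoinRoot.root f - AdjoinRoot.of f c) * AdjoinRoot.mk f q := by
        have := congrArg (AdjoinRoot.mk f) hq
        rw [map_sub, map_mul, map_sub, AdjoinRoot.mk_X, AdjoinRoot.mk_C, AdjoinRoot.mk_C] at this
        rw [← this]
        ring
      rw [hg, ← hr, map_mul, ← hτp]
      exact Ideal.add_mem _
        (Ideal.mul_mem_left _ _
          (Ideal.pow_mem_of_mem _ (Ideal.mem_span_singleton_self _) _ hp.pos))
        (Ideal.mul_mem_right _ _ (Ideal.mem_span_singleton_self _))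
    · rw [Ideal.span_singleton_le_iff_mem, RingHom.mem_ker, map_sub, hφ_def, AdjoinRoot.lift_root,
        AdjoinRoot.lift_of, sub_self]
  -- Step 4: `emb dim O'/(τ) + 1 = emb dim O'` and `O'/(τ) ≅ O/(m)`
  haveI : Nontrivial (AdjoinRoot f ⧸ Ideal.span {AdjoinRoot.root f - AdjoinRoot.of f c}) :=
    Ideal.Quotient.nontrivial_iff.mpr (Ideal.span_singleton_ne_top hτM)
  haveI : IsLocalRing (AdjoinRoot f ⧸ Ideal.span {AdjoinRoot.root f - AdjoinRoot.of f c}) :=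
    .of_surjective' _ Ideal.Quotient.mk_surjective
  have h4 := spanFinrank_maximalIdeal_quotient_add_one hτM hτ2
  haveI : Nontrivial (O ⧸ I) := Ideal.Quotient.nontrivial_iff.mpr (Ideal.span_singleton_ne_top hm)
  haveI : IsLocalRing (O ⧸ I) := .of_surjective' _ Ideal.Quotient.mk_surjective
  let e : (AdjoinRoot f ⧸ Ideal.span {AdjoinRoot.root f - AdjoinRoot.of f c}) ≃+* O ⧸ I :=
    (Ideal.quotEquivOfEq hker.symm).trans (RingHom.quotientKerEquivOfSurjective hsurj)
  have h5 : (maximalIdeal (AdjoinRoot f ⧸ Ideal.span {AdjoinRoot.root f - AdjoinRoot.of f c})).spanFinrank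
      = (maximalIdeal (O ⧸ I)).spanFinrank := by
    rw [← map_ringEquiv_maximalIdeal e, Ideal.spanFinrank_map_eq_of_ringEquiv]
  -- Step 5: `emb dim O/(m) = emb dim O` since `m ∈ 𝔪²`
  haveI : IsLocalHom (Ideal.Quotient.mk I) := IsLocalHom.of_surjective _ Ideal.Quotient.mk_surjective
  have h6 := spanFinrank_maximalIdeal_add_finrank_eq_of_surjective (R := O) (S := O ⧸ I)
    Ideal.Quotient.mk_surjective
  have h7 : Submodule.span (ResidueField O) ((maximalIdeal O).toCotangent ''
      (Submodule.comap (maximalIdeal O).subtype (RingHom.ker (algebraMap O (O ⧸ I))) :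
        Set (maximalIdeal O))) = ⊥ := by
    rw [Submodule.span_eq_bot]
    rintro _ ⟨x, hx, rfl⟩
    rw [Ideal.toCotangent_eq_zero]
    have hx' : (x : O) ∈ I := by
      simpa [Ideal.Quotient.algebraMap_eq, Ideal.mk_ker] using hx
    rw [hI_def, Ideal.mem_span_singleton'] at hx'
    obtain ⟨r, hr⟩ := hx'
    rw [← hr]
    exact Ideal.mul_mem_left _ r hm2
  rw [h7, finrank_bot, add_zero] at h6
  -- Step 6: count
  have hA := (isRegularLocalRing_iff (AdjoinRoot f)).mp ‹_›
  have hO := (isRegularLocalRing_iff O).mp ‹_›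
  have hdim : ringKrullDim (AdjoinRoot f) ≤ ringKrullDim O :=
    Literature.RingTheory.KrullDimension.ringKrullDim_le_of_isIntegral
  rw [← hA, ← hO] at hdim
  have h8 : (maximalIdeal (AdjoinRoot f)).spanFinrank ≤ (maximalIdeal O).spanFinrank := by
    exact_mod_cast hdim
  omega

end Summit.ResolutionOfSingularities.ResolutionOfSingularities.Theorems.PicoverLocalModel.DegenerateExit

end
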